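import Summits.AtomisticToContinuum.Crystallization.Theorems.FrustratedLawDichotomyExemptMove
import Summits.AtomisticToContinuum.Crystallization.Theorems.FrustratedLawDichotomyFarFieldSharp

/-!
# FrustratedLawDichotomy · crux `AperiodicFrustratedLawGap` (stmt-AtomisticToContinuum-27623) — the DIPOLE far-field slack for the
# one-atom move certificate (decomp-a2c, prover hand 2, structural share, generation 15; DEF-FREE, finite sums only)

`…ExemptMove.exchangeUnstable_one_of_localMove` certifies the cluster-level exemption `ExchangeUnstable ε ϱ 1 y j` from a MOTIF-LOCAL
one-atom move `y_j ↦ p` whose gain over the atoms within `Rm` of `y_j` exceeds `ε + 2·T(D)` (`Rm ≥ ϱ + D`): the two far fields (at `y_j` and at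
`p`) are bounded SEPARATELY by `T(D)` each.  For the census's Nash moves (step `|p − y_j| ≈ 10⁻²`, gain `g_j ≈ 1.3·10⁻³`; hand-1 g14 HAND1-G14.md)
this is hopeless even with the sharp `T♯` of `…FarFieldSharp` (`2T♯(10) ≈ 10⁻²`).  What changes under the move is a DIPOLE: for a far atom `q`
at distance `d ≥ Rm ≥ 1 + s` from `y_j` and a step `|p − y_j| ≤ s`,
`|V_LJ(|p − q|) − V_LJ(|y_j − q|)| ≤ s·(d − s)⁻⁷ ≤ s·(Rm/(Rm − s))⁷·d⁻⁷` (`V_LJ` is `1`-Lipschitz with weight `min⁻⁷` beyond `1`), and the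
sharp packing sum `Σ_{d ≥ Rm} d⁻⁷ ≤ S₇♯(Rm) = 6000/(343Rm⁴) + 2880/(49Rm⁵) + 10/(7Rm⁶) + 2/Rm⁷` (`…FarFieldSharp.sum_inv_pow_le_of_separated_sharp`,
`k = 4`, `δ = 7/10`) gives:

* `abs_lennardJones_sub_le` — `|V_LJ(a) − V_LJ(b)| ≤ |a − b|·(min a b)⁻⁷` for `a, b ≥ 1`;
* `abs_lennardJones_move_sub_le` — the per-atom dipole bound above; `sum_far_inv_pow_seven_le` — `Σ_{k ≠ j, |y_k − y_j| > Rm} |y_k − y_j|⁻⁷ ≤ S₇♯(Rm)`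
  over an injective `7/10`-separated cluster; `abs_sum_far_move_le` — the far part of the move gain is at most `s·(Rm/(Rm−s))⁷·S₇♯(Rm)`;
* ★ `exchangeUnstable_one_of_localMove_dipole` — `Sep y`, `y` injective, `dist p (y j) ≤ min ϱ s`, `dist p (y j) < 7/10`, `1 + s ≤ Rm`, and the
  LOCAL gain (both sums over `k ≠ j` with `dist (y k) (y j) ≤ Rm`) exceeds `ε + s·(Rm/(Rm−s))⁷·S₇♯(Rm)` ⟹ `ExchangeUnstable ε ϱ 1 y j`
  (hence the site is refunded in every exchange-exempt price: `…ExemptLocOpt.aperiodicFrustratedLawGap_of_schurCut_exchange_fourHalf`,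
  `…ExemptSplit.aperiodicFrustratedLawGap_of_split_exchange_fourHalf`; deep-absent by `…ExemptLocOpt.deepAbsent_exchangeUnstable`);
* numerals: the slack is `≤ 3/5000` at `(Rm, s) = (7, 1/20)`, `≤ 1/4000` at `(7, 1/50)`, `≤ 1/8000` at `(10, 1/20)` — below the census's
  one-atom gains `g_j ≈ 1.3·10⁻³` of the force-bearing thin adversaries, so the motif-local exemption test BITES AT `Rm = 7`.

All `[folklore]`; 0 sorry; `--supports stmt-AtomisticToContinuum-27623`.
-/

noncomputable section

namespace Summit.AtomisticToContinuum.Crystallization.Theorems.FrustratedLawDichotomyExemptMoveDipole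

open Metric
open scoped BigOperators
open Literature.MathematicalPhysics.StatisticalMechanics
open Summit.AtomisticToContinuum.Crystallization.Theorems.FrustratedLawDichotomyExemptLocOpt (ExchangeUnstable)
open Summit.AtomisticToContinuum.Crystallization.Theorems.FrustratedLawDichotomyExemptMove (exchangeUnstable_one_of_move)
open Summit.AtomisticToContinuum.Crystallization.Theorems.FrustratedLawDichotomyFarFieldSharp
  (inv_pow_sub_inv_pow_le inv_pow_le_inv_pow_of_le sum_inv_pow_le_of_separated_sharp)
open Summit.AtomisticToContinuum.Crystallization.Theorems.FrustratedLawDichotomyRangeCut (Sep)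

/-! ## §1. The Lennard-Jones potential is `min⁻⁷`-Lipschitz beyond `1` -/

/-- `|V_LJ(a) − V_LJ(b)| ≤ (a − b)·b⁻⁷` for `1 ≤ b ≤ a` (`V_LJ = r⁻¹²/12 − r⁻⁶/6`; `b⁻⁶ − a⁻⁶ ≤ 6(a−b)b⁻⁷`, `b⁻¹² − a⁻¹² ≤ 12(a−b)b⁻¹³ ≤ 12(a−b)b⁻⁷`,
and the two enter with opposite signs). [folklore] -/
theorem abs_lennardJones_sub_le_of_le {a b : ℝ} (hb : 1 ≤ b) (hba : b ≤ a) :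
    |lennardJones a - lennardJones b| ≤ (a - b) * b⁻¹ ^ 7 := by
  have hb0 : 0 < b := by linarith
  have hab : 0 ≤ a - b := by linarith
  have hi0 : 0 ≤ b⁻¹ := inv_nonneg.2 hb0.le
  have hi1 : b⁻¹ ≤ 1 := inv_le_one_of_one_le₀ hb
  have h6 := inv_pow_sub_inv_pow_le hb0 hba 6
  have h12 := inv_pow_sub_inv_pow_le hb0 hba 12
  have h6' : a⁻¹ ^ 6 ≤ b⁻¹ ^ 6 := inv_pow_le_inv_pow_of_le hb0 hba 6
  have h12' : a⁻¹ ^ 12 ≤ b⁻¹ ^ 12 := inv_pow_le_inv_pow_of_le hb0 hba 12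
  have h137 : b⁻¹ ^ (12 + 1) ≤ b⁻¹ ^ 7 := pow_le_pow_of_le_one hi0 hi1 (by norm_num)
  have h7 : b⁻¹ ^ (6 + 1) = b⁻¹ ^ 7 := by norm_num
  rw [h7] at h6
  have h12'' : b⁻¹ ^ 12 - a⁻¹ ^ 12 ≤ 12 * (a - b) * b⁻¹ ^ 7 :=
    h12.trans (mul_le_mul_of_nonneg_left h137 (by positivity))
  unfold lennardJones
  rw [abs_le]
  constructor <;> nlinarith

/-- **`|V_LJ(a) − V_LJ(b)| ≤ |a − b|·(min a b)⁻⁷` for `a, b ≥ 1`.** [folklore] -/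
theorem abs_lennardJones_sub_le {a b : ℝ} (ha : 1 ≤ a) (hb : 1 ≤ b) :
    |lennardJones a - lennardJones b| ≤ |a - b| * (min a b)⁻¹ ^ 7 := by
  rcases le_total b a with hba | hab
  · rw [min_eq_right hba, abs_of_nonneg (sub_nonneg.2 hba)]
    exact abs_lennardJones_sub_le_of_le hb hba
  · rw [min_eq_left hab, abs_sub_comm (lennardJones a) (lennardJones b), abs_sub_comm a b,
      abs_of_nonneg (sub_nonneg.2 hab)]
    exact abs_lennardJones_sub_le_of_le ha hab

/-! ## §2. The per-atom dipole bound and the far sum -/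

/-- **Per-atom DIPOLE bound**: if `dist p c ≤ s`, `1 + s ≤ Rm ≤ dist q c`, then
`|V_LJ(dist p q) − V_LJ(dist c q)| ≤ s·(Rm/(Rm − s))⁷·(dist q c)⁻⁷`. [folklore] -/
theorem abs_lennardJones_move_sub_le {c p q : EuclideanSpace ℝ (Fin 3)} {s Rm : ℝ} (hps : dist p c ≤ s) (hRm : 1 + s ≤ Rm)
    (hq : Rm ≤ dist q c) :
    |lennardJones (dist p q) - lennardJones (dist c q)| ≤ s * (Rm / (Rm - s)) ^ 7 * (dist q c)⁻¹ ^ 7 := by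
  have hs0 : 0 ≤ s := dist_nonneg.trans hps
  set d : ℝ := dist q c with hd
  have hdc : dist c q = d := dist_comm c q
  have hRs : 1 ≤ Rm - s := by linarith
  have hd1 : 1 + s ≤ d := hRm.trans hq
  -- the moved distance is within `s` of `d`
  have htri : |dist p q - dist c q| ≤ dist p c := abs_dist_sub_le p c q
  rw [hdc] at htri
  have hlo : d - s ≤ dist p q := by
    have := (abs_le.1 (htri.trans hps)).1
    linarith
  have hds0 : 0 < d - s := by linarith
  have hmin : d - s ≤ min (dist p q) d := le_min hlo (by linarith)
  have h1p : 1 ≤ dist p q := le_trans (by linarith) hlo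
  have h1d : 1 ≤ d := by linarith
  have hV := abs_lennardJones_sub_le h1p h1d
  rw [hdc]
  -- `|V(dist p q) − V(d)| ≤ s·(min)⁻⁷ ≤ s·(d − s)⁻⁷`
  have hmin7 : (min (dist p q) d)⁻¹ ^ 7 ≤ (d - s)⁻¹ ^ 7 := inv_pow_le_inv_pow_of_le hds0 hmin 7
  have hstep : |lennardJones (dist p q) - lennardJones d| ≤ s * (d - s)⁻¹ ^ 7 :=
    hV.trans (mul_le_mul (htri.trans hps) hmin7 (by positivity) hs0)
  -- `(d − s)⁻¹ ≤ (Rm/(Rm − s))·d⁻¹` since `d ≥ Rm`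
  have hd0 : 0 < d := by linarith
  have hratio : (d - s)⁻¹ ≤ Rm / (Rm - s) * d⁻¹ := by
    have hRs0 : 0 < Rm - s := by linarith
    have h1 : Rm / (Rm - s) * d⁻¹ = Rm / ((Rm - s) * d) := by field_simp
    rw [h1, inv_eq_one_div, div_le_div_iff₀ hds0 (by positivity)]
    nlinarith [mul_le_mul_of_nonneg_left hq hs0]
  have hratio7 : (d - s)⁻¹ ^ 7 ≤ (Rm / (Rm - s)) ^ 7 * d⁻¹ ^ 7 := by
    rw [← mul_pow]
    exact pow_le_pow_left₀ (inv_nonneg.2 hds0.le) hratio 7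
  calc |lennardJones (dist p q) - lennardJones d| ≤ s * (d - s)⁻¹ ^ 7 := hstep
    _ ≤ s * ((Rm / (Rm - s)) ^ 7 * d⁻¹ ^ 7) := mul_le_mul_of_nonneg_left hratio7 hs0
    _ = s * (Rm / (Rm - s)) ^ 7 * d⁻¹ ^ 7 := by ring

/-- **Sharp far `r⁻⁷` sum over a cluster** (`…FarFieldSharp.sum_inv_pow_le_of_separated_sharp`, `k = 4`, `δ = 7/10`): for an injective
`7/10`-separated `y` and `Rm ≥ 7/20`, `Σ_{k ≠ j, |y_k − y_j| > Rm} |y_k − y_j|⁻⁷ ≤ S₇♯(Rm) = 6000/(343Rm⁴) + 2880/(49Rm⁵) + 10/(7Rm⁶) + 2/Rm⁷`. [folklore] -/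
theorem sum_far_inv_pow_seven_le {Rm : ℝ} (hRm : (7 : ℝ) / 20 ≤ Rm) {N : ℕ} {y : Fin N → EuclideanSpace ℝ (Fin 3)} {j : Fin N}
    (hsep : Sep y) (hy : Function.Injective y) :
    ∑ k ∈ (Finset.univ.erase j).filter (fun k => ¬ dist (y k) (y j) ≤ Rm), (dist (y k) (y j))⁻¹ ^ 7 ≤
      6000 / 343 * Rm⁻¹ ^ 4 + 2880 / 49 * Rm⁻¹ ^ 5 + 10 / 7 * Rm⁻¹ ^ 6 + 2 * Rm⁻¹ ^ 7 := by
  classical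
  set far := (Finset.univ.erase j).filter (fun k => ¬ dist (y k) (y j) ≤ Rm) with hfar
  have himg : ∑ k ∈ far, (dist (y k) (y j))⁻¹ ^ 7 = ∑ a ∈ far.image y, (dist a (y j))⁻¹ ^ 7 := by
    rw [Finset.sum_image fun a _ b _ h => hy h]
  rw [himg]
  have hsep' : ∀ a ∈ far.image y, ∀ b ∈ far.image y, a ≠ b → (7 : ℝ) / 10 ≤ dist a b := by
    intro a ha b hb hab
    obtain ⟨k, -, rfl⟩ := Finset.mem_image.1 ha
    obtain ⟨l, -, rfl⟩ := Finset.mem_image.1 hb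
    exact hsep k l fun h => hab (by rw [h])
  have hfar' : ∀ a ∈ far.image y, Rm ≤ dist a (y j) := by
    intro a ha
    obtain ⟨k, hk, rfl⟩ := Finset.mem_image.1 ha
    exact (not_le.1 (Finset.mem_filter.1 hk).2).le
  have h := sum_inv_pow_le_of_separated_sharp (far.image y) (y j) (k := 4) (by norm_num) (by norm_num : (0 : ℝ) < 7 / 10)
    (by linarith) hsep' hfar'
  refine h.trans (le_of_eq ?_)
  norm_num

/-- **The far part of a one-atom move gain** (`|p − y_j| ≤ s`, `1 + s ≤ Rm`):
`|Σ_{k ≠ j, |y_k − y_j| > Rm} [V_LJ(|p − y_k|) − V_LJ(|y_j − y_k|)]| ≤ s·(Rm/(Rm − s))⁷·S₇♯(Rm)`. [folklore] -/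
theorem abs_sum_far_move_le {Rm s : ℝ} {N : ℕ} {y : Fin N → EuclideanSpace ℝ (Fin 3)} {j : Fin N}
    (hsep : Sep y) (hy : Function.Injective y) {p : EuclideanSpace ℝ (Fin 3)} (hps : dist p (y j) ≤ s) (hRm : 1 + s ≤ Rm) :
    |∑ k ∈ (Finset.univ.erase j).filter (fun k => ¬ dist (y k) (y j) ≤ Rm),
        (lennardJones (dist p (y k)) - lennardJones (dist (y j) (y k)))| ≤
      s * (Rm / (Rm - s)) ^ 7 * (6000 / 343 * Rm⁻¹ ^ 4 + 2880 / 49 * Rm⁻¹ ^ 5 + 10 / 7 * Rm⁻¹ ^ 6 + 2 * Rm⁻¹ ^ 7) := by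
  classical
  have hs0 : 0 ≤ s := dist_nonneg.trans hps
  have hRs : 0 < Rm - s := by linarith
  have hc : 0 ≤ s * (Rm / (Rm - s)) ^ 7 := mul_nonneg hs0 (pow_nonneg (div_nonneg (by linarith) hRs.le) 7)
  refine (Finset.abs_sum_le_sum_abs _ _).trans ?_
  have hterm : ∀ k ∈ (Finset.univ.erase j).filter (fun k => ¬ dist (y k) (y j) ≤ Rm),
      |lennardJones (dist p (y k)) - lennardJones (dist (y j) (y k))| ≤ s * (Rm / (Rm - s)) ^ 7 * (dist (y k) (y j))⁻¹ ^ 7 :=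
    fun k hk => abs_lennardJones_move_sub_le hps hRm (not_le.1 (Finset.mem_filter.1 hk).2).le
  refine (Finset.sum_le_sum hterm).trans ?_
  rw [← Finset.mul_sum]
  exact mul_le_mul_of_nonneg_left (sum_far_inv_pow_seven_le (by linarith) hsep hy) hc

/-! ## §3. The one-atom move certificate with the dipole slack -/

/-- ★ **LOCAL MOVE GAIN ⟹ CLUSTER-LEVEL EXEMPTION, DIPOLE slack**: over a `7/10`-separated injective cluster, a one-atom move `y_j ↦ p` with
`dist p (y j) ≤ ϱ`, `dist p (y j) < 7/10`, `dist p (y j) ≤ s` and `1 + s ≤ Rm`, whose gain computed from the atoms within `Rm` of `y_j` only exceeds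
`ε + s·(Rm/(Rm − s))⁷·S₇♯(Rm)`, certifies `ExchangeUnstable ε ϱ 1 y j` — the far atoms change the gain by a dipole term only. [folklore] -/
theorem exchangeUnstable_one_of_localMove_dipole {ε ϱ Rm s : ℝ} {N : ℕ} {y : Fin N → EuclideanSpace ℝ (Fin 3)} {j : Fin N}
    (hsep : Sep y) (hy : Function.Injective y) {p : EuclideanSpace ℝ (Fin 3)} (hpϱ : dist p (y j) ≤ ϱ) (hp7 : dist p (y j) < 7 / 10)
    (hps : dist p (y j) ≤ s) (hRm : 1 + s ≤ Rm)
    (hgain : (∑ k ∈ (Finset.univ.erase j).filter (fun k => dist (y k) (y j) ≤ Rm), lennardJones (dist p (y k))) +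
        (ε + s * (Rm / (Rm - s)) ^ 7 * (6000 / 343 * Rm⁻¹ ^ 4 + 2880 / 49 * Rm⁻¹ ^ 5 + 10 / 7 * Rm⁻¹ ^ 6 + 2 * Rm⁻¹ ^ 7)) <
      ∑ k ∈ (Finset.univ.erase j).filter (fun k => dist (y k) (y j) ≤ Rm), lennardJones (dist (y j) (y k))) :
    ExchangeUnstable ε ϱ 1 N y j := by
  classical
  apply exchangeUnstable_one_of_move hsep hy hpϱ hp7
  rw [siteEnergy]
  have hsplit : ∀ g : Fin N → ℝ, ∑ k ∈ Finset.univ.erase j, g k =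
      (∑ k ∈ (Finset.univ.erase j).filter (fun k => dist (y k) (y j) ≤ Rm), g k) +
        ∑ k ∈ (Finset.univ.erase j).filter (fun k => ¬ dist (y k) (y j) ≤ Rm), g k :=
    fun g => (Finset.sum_filter_add_sum_filter_not _ _ g).symm
  rw [hsplit (fun k => lennardJones (dist p (y k))), hsplit (fun k => lennardJones (dist (y j) (y k)))]
  have hfar := abs_sum_far_move_le (Rm := Rm) hsep hy hps hRm
  rw [Finset.sum_sub_distrib] at hfar
  have hfar' := (abs_le.1 hfar).2
  linarith

/-! ## §4. Numerals for the census (the dipole slack at small radii) -/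

/-- At `Rm = 7`, steps `s ≤ 1/20`: the dipole slack is `≤ 3/5000` (`< g_j ≈ 1.3·10⁻³` of the census's force-bearing adversaries). [folklore] -/
theorem dipoleSlack_seven_twentieth_le :
    (1 / 20 : ℝ) * ((7 : ℝ) / (7 - 1 / 20)) ^ 7 *
        (6000 / 343 * (7 : ℝ)⁻¹ ^ 4 + 2880 / 49 * (7 : ℝ)⁻¹ ^ 5 + 10 / 7 * (7 : ℝ)⁻¹ ^ 6 + 2 * (7 : ℝ)⁻¹ ^ 7) ≤ 3 / 5000 := by
  norm_num

/-- At `Rm = 7`, steps `s ≤ 1/50`: the dipole slack is `≤ 1/4000`. [folklore] -/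
theorem dipoleSlack_seven_fiftieth_le :
    (1 / 50 : ℝ) * ((7 : ℝ) / (7 - 1 / 50)) ^ 7 *
        (6000 / 343 * (7 : ℝ)⁻¹ ^ 4 + 2880 / 49 * (7 : ℝ)⁻¹ ^ 5 + 10 / 7 * (7 : ℝ)⁻¹ ^ 6 + 2 * (7 : ℝ)⁻¹ ^ 7) ≤ 1 / 4000 := by
  norm_num

/-- At `Rm = 10`, steps `s ≤ 1/20`: the dipole slack is `≤ 1/8000`. [folklore] -/
theorem dipoleSlack_ten_twentieth_le :
    (1 / 20 : ℝ) * ((10 : ℝ) / (10 - 1 / 20)) ^ 7 *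
        (6000 / 343 * (10 : ℝ)⁻¹ ^ 4 + 2880 / 49 * (10 : ℝ)⁻¹ ^ 5 + 10 / 7 * (10 : ℝ)⁻¹ ^ 6 + 2 * (10 : ℝ)⁻¹ ^ 7) ≤ 1 / 8000 := by
  norm_num

/-- **The slack is monotone in the step**: for `0 ≤ s ≤ s'`, `1 + s' ≤ Rm`, the slack at `s` is at most the slack at `s'` — a certificate may use
any rational upper bound `s'` of the step. [folklore] -/
theorem dipoleSlack_mono {s s' Rm : ℝ} (hs : 0 ≤ s) (hss' : s ≤ s') (hRm : 1 + s' ≤ Rm) :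
    s * (Rm / (Rm - s)) ^ 7 * (6000 / 343 * Rm⁻¹ ^ 4 + 2880 / 49 * Rm⁻¹ ^ 5 + 10 / 7 * Rm⁻¹ ^ 6 + 2 * Rm⁻¹ ^ 7) ≤
      s' * (Rm / (Rm - s')) ^ 7 * (6000 / 343 * Rm⁻¹ ^ 4 + 2880 / 49 * Rm⁻¹ ^ 5 + 10 / 7 * Rm⁻¹ ^ 6 + 2 * Rm⁻¹ ^ 7) := by
  have hRm0 : 0 < Rm := by linarith
  have hRs' : 0 < Rm - s' := by linarith
  have hRs : 0 < Rm - s := by linarith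
  have hS : 0 ≤ 6000 / 343 * Rm⁻¹ ^ 4 + 2880 / 49 * Rm⁻¹ ^ 5 + 10 / 7 * Rm⁻¹ ^ 6 + 2 * Rm⁻¹ ^ 7 := by positivity
  have hratio : Rm / (Rm - s) ≤ Rm / (Rm - s') := div_le_div_of_nonneg_left hRm0.le hRs' (by linarith)
  have hratio7 : (Rm / (Rm - s)) ^ 7 ≤ (Rm / (Rm - s')) ^ 7 := pow_le_pow_left₀ (by positivity) hratio 7
  refine mul_le_mul_of_nonneg_right ?_ hS
  exact mul_le_mul hss' hratio7 (by positivity) (hs.trans hss')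

end Summit.AtomisticToContinuum.Crystallization.Theorems.FrustratedLawDichotomyExemptMoveDipole

end
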